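import Mathlib
import HarnessLib
import Summits.Ventures.LatticeQCDFlow.Exactness.SU2ResidualStencilVolumeUniform
import Summits.Ventures.LatticeQCDFlow.Exactness.SU2ResidualSquash

/-!
# THE ENGINE'S PARAMETRISATION, END TO END: a learned `SU(2)` residual member whose weights are `(κ_t/(2(d−1)))·tanh` of a periodic window-stencil network of masked plaquette features — ONLY SMOOTHNESS OF THE READOUT REMAINS A HYPOTHESIS — and FT-HMC with the exact force as run converges below ONE trajectory-length threshold `τ₀` on EVERY torus

HONEST FRAMING: exact (Metropolis-corrected) sampling algorithms for lattice gauge theory;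
figures of merit are autocorrelation/cost numbers at stated couplings and volumes; no
continuum-physics claim.

Venture `LatticeQCDFlow` (cell pub-lqcd), topic `Exactness`; FANOUT row 14 (`eng-flowhmc`, engine
`latflow.fthmc`, family B; `maps.residual_scan_rho`: "rho (V, Jn) = (kappa/Jn) tanh(CNN_w(frozen-plaquette
features))", `Jn = 2(D−1)`, `kappa_target < 1`).  NEW WORK of the cell over the tree
(`SU2ResidualStencilVolumeUniform`: volume-uniformity for masked window-stencil conditioners with (ρD),
(ρC), (ρκ) and the frozen-feature property as the remaining hypotheses; `SU2ResidualSquash`: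
`sum_squash_le` — the tanh squash puts the weights inside the refusal rule BY CONSTRUCTION,
`continuous_tanh_real`); nothing is cited as a fact; no number.  GEN-16 programme, final corollary.  The
weights, VERBATIM on every side `M`:

  `ρ^{(M)}_s(V)(e, ν, t) = (κ_t/(2(d−1))) · tanh (Ψ s e.2 ν t (z ↦ feat s (Σᵢ(e.1+z)ᵢ mod w) (U_{μ'ν'}(V)(e.1+z))))`.

* **`su2ResidualSquashStencil_member_fthmcN_exactForce_uniformlyErgodic_allVolumes`** — phase masks of
  width `w > 1`, ANY schedule with `|c_s|·κ_t ≤ κ₀ < 1` (`0 ≤ κ_t`), ANY measurable raw readout `Ψ` and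
  measurable frozen-masked feature map `feat`, the squashed weights differentiable / `C^n` along link
  fields (ρD)/(ρC), every `β, κ, κ' > 0`: THERE IS `τ₀ > 0` such that FOR EVERY side `L` with `w ∣ L` the
  learned member exists (layers VERBATIM with these weights), its exact force is measurable, and for
  every `n ≥ 1`, `ε' > 0` with `nε' ≤ τ₀` the reported `n`-step FT-HMC kernel with the exact force as
  run converges to `wilsonMeasure SU(2).subtype β` from EVERY start, geometrically in total variation.

WHAT REMAINS A HYPOTHESIS, honestly: (ρD)/(ρC) — smoothness of `tanh ∘ Ψ ∘ feat` along smooth link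
fields (true for smooth activations; the engine's LeakyReLU nets are not `C¹` at the kinks); that the
checkpoint's feature mask is the frozen-plaquette mask `hfeat`.  NOT CLAIMED: values; a volume-uniform
rate; longer trajectories; OMF; floating point.
-/

noncomputable section

namespace Summit.Ventures.LatticeQCDFlow.Exactness

open Set Function MeasureTheory ProbabilityTheory ProbabilityTheory.Kernel InnerProductGeometry WithLp NormedSpace
open Literature.MathematicalPhysics.QuantumFieldTheory
open Literature.MathematicalPhysics.QuantumFieldTheory.Balaban1983to89.B10Eq18SigmaSU2Haar (expPauli)
open scoped ENNReal Matrix Matrix.Norms.Operator NNReal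

set_option backward.isDefEq.respectTransparency false

section Squash

variable {d : ℕ} {σ : Type*} {Φ : Type*} [MeasurableSpace Φ]

/-- **THE ENGINE'S PARAMETRISATION, END TO END** (`ρ = (κ_t/(2(d−1)))·tanh ∘ Ψ` of masked window
features): (ρN), (ρT), (ρL), (ρloc), (ρm) AND the refusal bound (ρκ) are discharged; smoothness
(ρD)/(ρC) and the frozen-feature property remain as stated. -/
theorem su2ResidualSquashStencil_member_fthmcN_exactForce_uniformlyErgodic_allVolumes (w : ℕ) [Fact (1 < w)]
    (μf : σ → Fin d) (bf : σ → ZMod w) (cf : σ → ℝ) (m : ℕ)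
    (feat : σ → ZMod w → (Fin d → Fin d → Matrix.specialUnitaryGroup (Fin 2) ℂ) → Φ)
    (Ψ : σ → Fin d → Fin d → Fin 2 → ({z : Fin d → ℤ // ∀ i, |z i| ≤ ((m : ℕ) : ℤ)} → Φ) → ℝ)
    {κt : ℝ} (hκt : 0 ≤ κt) {κ₀ : ℝ} (hκ0 : 0 ≤ κ₀) (hκ₀ : κ₀ < 1) (hcκ : ∀ s : σ, |cf s| * κt ≤ κ₀)
    (hρD : (∀ (M : ℕ) [NeZero M] (s : σ) (U : (Edge d M → EuclideanSpace ℝ (Fin 3)) → GaugeConfig d M (Matrix.specialUnitaryGroup (Fin 2) ℂ))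
      (p₀ : Edge d M → EuclideanSpace ℝ (Fin 3)),
      (∀ e : Edge d M, DifferentiableAt ℝ (fun p => ((U p e : (Matrix.specialUnitaryGroup (Fin 2) ℂ)) : Matrix (Fin 2) (Fin 2) ℂ)) p₀) →
      ∀ (e : Edge d M) (ν : Fin d) (b : Fin 2), DifferentiableAt ℝ (fun p => ((fun s μ ν t F => κt / (2 * ((d - 1 : ℕ) : ℝ)) * Real.tanh (Ψ s μ ν t F)) s e.2 ν b (fun z : {z : Fin d → ℤ // ∀ i, |z i| ≤ ((m : ℕ) : ℤ)} =>
          feat s (ZMod.cast (∑ j, (e.1 + (fun i => ((z.1 i : ℤ) : ZMod M))) j) : ZMod w) (fun μ' ν' => plaquetteHolonomy (U p) (e.1 + (fun i => ((z.1 i : ℤ) : ZMod M))) μ' ν')))) p₀))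
    (hρC : (∀ (M : ℕ) [NeZero M] {n : WithTop ℕ∞} (s : σ) (U : (Edge d M → Matrix (Fin 2) (Fin 2) ℂ) × (Edge d M → EuclideanSpace ℝ (Fin 3)) → GaugeConfig d M (Matrix.specialUnitaryGroup (Fin 2) ℂ)) (p₀ : (Edge d M → Matrix (Fin 2) (Fin 2) ℂ) × (Edge d M → EuclideanSpace ℝ (Fin 3))),
      (∀ e : Edge d M, ContDiffAt ℝ n (fun p : (Edge d M → Matrix (Fin 2) (Fin 2) ℂ) × (Edge d M → EuclideanSpace ℝ (Fin 3)) => ((U p e : (Matrix.specialUnitaryGroup (Fin 2) ℂ)) : Matrix (Fin 2) (Fin 2) ℂ)) p₀) →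
      ∀ (e : Edge d M) (ν : Fin d) (b : Fin 2), ContDiffAt ℝ n (fun p : (Edge d M → Matrix (Fin 2) (Fin 2) ℂ) × (Edge d M → EuclideanSpace ℝ (Fin 3)) => ((fun s μ ν t F => κt / (2 * ((d - 1 : ℕ) : ℝ)) * Real.tanh (Ψ s μ ν t F)) s e.2 ν b (fun z : {z : Fin d → ℤ // ∀ i, |z i| ≤ ((m : ℕ) : ℤ)} =>
          feat s (ZMod.cast (∑ j, (e.1 + (fun i => ((z.1 i : ℤ) : ZMod M))) j) : ZMod w) (fun μ' ν' => plaquetteHolonomy (U p) (e.1 + (fun i => ((z.1 i : ℤ) : ZMod M))) μ' ν')))) p₀))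
    (hfeatm : ∀ (s : σ) (c : ZMod w), Measurable (feat s c))
    (hΨm : ∀ (s : σ) (μ ν : Fin d) (t : Fin 2), Measurable (Ψ s μ ν t))
    (hfeat : ∀ (s : σ) (c : ZMod w) (P P' : Fin d → Fin d → Matrix.specialUnitaryGroup (Fin 2) ℂ),
      (∀ μ' ν' : Fin d, μ' ≠ ν' → ((μf s ≠ μ' ∧ μf s ≠ ν') ∨ (c ≠ bf s ∧ c + 1 ≠ bf s)) → P μ' ν' = P' μ' ν') →
      feat s c P = feat s c P')
    (sched : List σ) (β κ : ℝ) {κ' : ℝ} (hκ' : 0 < κ') :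
    ∃ τ₀ : ℝ, 0 < τ₀ ∧ ∀ (L : ℕ) [NeZero L] (hwL : w ∣ L),
    ∃ layers : List ((GaugeConfig d L (Matrix.specialUnitaryGroup (Fin 2) ℂ) ≃ᵐ GaugeConfig d L (Matrix.specialUnitaryGroup (Fin 2) ℂ)) × (GaugeConfig d L (Matrix.specialUnitaryGroup (Fin 2) ℂ) → ℝ)),
      layers.map (fun Ly => ((Ly.1 : GaugeConfig d L (Matrix.specialUnitaryGroup (Fin 2) ℂ) → GaugeConfig d L (Matrix.specialUnitaryGroup (Fin 2) ℂ)), Ly.2)) =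
        sched.map (fun s =>
          ((fun (V : GaugeConfig d L (Matrix.specialUnitaryGroup (Fin 2) ℂ)) (e : Edge d L) =>
        if e.2 = μf s ∧ (ZMod.castHom hwL (ZMod w) (∑ j, e.1 j)) = bf s then
          gaussUnit (geodesicKick (cf s) (∑ ν ∈ Finset.univ.erase e.2,
            (((fun s μ ν t F => κt / (2 * ((d - 1 : ℕ) : ℝ)) * Real.tanh (Ψ s μ ν t F)) s e.2 ν 0 (fun z : {z : Fin d → ℤ // ∀ i, |z i| ≤ ((m : ℕ) : ℤ)} =>
          feat s (ZMod.cast (∑ j, (e.1 + (fun i => ((z.1 i : ℤ) : ZMod L))) j) : ZMod w) (fun μ' ν' => plaquetteHolonomy V (e.1 + (fun i => ((z.1 i : ℤ) : ZMod L))) μ' ν'))) • vecQuat (((V (Site.shift e.1 e.2, ν) * (V (Site.shift e.1 ν, e.2))⁻¹ * (V (e.1, ν))⁻¹)⁻¹ : Matrix.specialUnitaryGroup (Fin 2) ℂ) : Matrix (Fin 2) (Fin 2) ℂ) +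
              ((fun s μ ν t F => κt / (2 * ((d - 1 : ℕ) : ℝ)) * Real.tanh (Ψ s μ ν t F)) s e.2 ν 1 (fun z : {z : Fin d → ℤ // ∀ i, |z i| ≤ ((m : ℕ) : ℤ)} =>
          feat s (ZMod.cast (∑ j, (e.1 + (fun i => ((z.1 i : ℤ) : ZMod L))) j) : ZMod w) (fun μ' ν' => plaquetteHolonomy V (e.1 + (fun i => ((z.1 i : ℤ) : ZMod L))) μ' ν'))) • vecQuat ((((V (Site.shift (e.1 - Pi.single ν 1) e.2, ν))⁻¹ * (V (e.1 - Pi.single ν 1, e.2))⁻¹ * V (e.1 - Pi.single ν 1, ν))⁻¹ : Matrix.specialUnitaryGroup (Fin 2) ℂ) : Matrix (Fin 2) (Fin 2) ℂ)))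
            (vecQuat ((V e : Matrix.specialUnitaryGroup (Fin 2) ℂ) : Matrix (Fin 2) (Fin 2) ℂ)))
        else V e),
           fun V : GaugeConfig d L (Matrix.specialUnitaryGroup (Fin 2) ℂ) => ∏ a : {e : Edge d L // e.2 = μf s ∧ (ZMod.castHom hwL (ZMod w) (∑ j, e.1 j)) = bf s},
          (if Real.sin (angle (∑ ν ∈ Finset.univ.erase a.1.2,
            (((fun s μ ν t F => κt / (2 * ((d - 1 : ℕ) : ℝ)) * Real.tanh (Ψ s μ ν t F)) s a.1.2 ν 0 (fun z : {z : Fin d → ℤ // ∀ i, |z i| ≤ ((m : ℕ) : ℤ)} =>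
          feat s (ZMod.cast (∑ j, (a.1.1 + (fun i => ((z.1 i : ℤ) : ZMod L))) j) : ZMod w) (fun μ' ν' => plaquetteHolonomy V (a.1.1 + (fun i => ((z.1 i : ℤ) : ZMod L))) μ' ν'))) • vecQuat (((V (Site.shift a.1.1 a.1.2, ν) * (V (Site.shift a.1.1 ν, a.1.2))⁻¹ * (V (a.1.1, ν))⁻¹)⁻¹ : Matrix.specialUnitaryGroup (Fin 2) ℂ) : Matrix (Fin 2) (Fin 2) ℂ) +
              ((fun s μ ν t F => κt / (2 * ((d - 1 : ℕ) : ℝ)) * Real.tanh (Ψ s μ ν t F)) s a.1.2 ν 1 (fun z : {z : Fin d → ℤ // ∀ i, |z i| ≤ ((m : ℕ) : ℤ)} =>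
          feat s (ZMod.cast (∑ j, (a.1.1 + (fun i => ((z.1 i : ℤ) : ZMod L))) j) : ZMod w) (fun μ' ν' => plaquetteHolonomy V (a.1.1 + (fun i => ((z.1 i : ℤ) : ZMod L))) μ' ν'))) • vecQuat ((((V (Site.shift (a.1.1 - Pi.single ν 1) a.1.2, ν))⁻¹ * (V (a.1.1 - Pi.single ν 1, a.1.2))⁻¹ * V (a.1.1 - Pi.single ν 1, ν))⁻¹ : Matrix.specialUnitaryGroup (Fin 2) ℂ) : Matrix (Fin 2) (Fin 2) ℂ))) (vecQuat ((V a.1 : Matrix.specialUnitaryGroup (Fin 2) ℂ) : Matrix (Fin 2) (Fin 2) ℂ))) = 0 then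
            (1 - cf s * ‖(∑ ν ∈ Finset.univ.erase a.1.2,
            (((fun s μ ν t F => κt / (2 * ((d - 1 : ℕ) : ℝ)) * Real.tanh (Ψ s μ ν t F)) s a.1.2 ν 0 (fun z : {z : Fin d → ℤ // ∀ i, |z i| ≤ ((m : ℕ) : ℤ)} =>
          feat s (ZMod.cast (∑ j, (a.1.1 + (fun i => ((z.1 i : ℤ) : ZMod L))) j) : ZMod w) (fun μ' ν' => plaquetteHolonomy V (a.1.1 + (fun i => ((z.1 i : ℤ) : ZMod L))) μ' ν'))) • vecQuat (((V (Site.shift a.1.1 a.1.2, ν) * (V (Site.shift a.1.1 ν, a.1.2))⁻¹ * (V (a.1.1, ν))⁻¹)⁻¹ : Matrix.specialUnitaryGroup (Fin 2) ℂ) : Matrix (Fin 2) (Fin 2) ℂ) +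
              ((fun s μ ν t F => κt / (2 * ((d - 1 : ℕ) : ℝ)) * Real.tanh (Ψ s μ ν t F)) s a.1.2 ν 1 (fun z : {z : Fin d → ℤ // ∀ i, |z i| ≤ ((m : ℕ) : ℤ)} =>
          feat s (ZMod.cast (∑ j, (a.1.1 + (fun i => ((z.1 i : ℤ) : ZMod L))) j) : ZMod w) (fun μ' ν' => plaquetteHolonomy V (a.1.1 + (fun i => ((z.1 i : ℤ) : ZMod L))) μ' ν'))) • vecQuat ((((V (Site.shift (a.1.1 - Pi.single ν 1) a.1.2, ν))⁻¹ * (V (a.1.1 - Pi.single ν 1, a.1.2))⁻¹ * V (a.1.1 - Pi.single ν 1, ν))⁻¹ : Matrix.specialUnitaryGroup (Fin 2) ℂ) : Matrix (Fin 2) (Fin 2) ℂ)))‖ * Real.cos (angle (∑ ν ∈ Finset.univ.erase a.1.2,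
            (((fun s μ ν t F => κt / (2 * ((d - 1 : ℕ) : ℝ)) * Real.tanh (Ψ s μ ν t F)) s a.1.2 ν 0 (fun z : {z : Fin d → ℤ // ∀ i, |z i| ≤ ((m : ℕ) : ℤ)} =>
          feat s (ZMod.cast (∑ j, (a.1.1 + (fun i => ((z.1 i : ℤ) : ZMod L))) j) : ZMod w) (fun μ' ν' => plaquetteHolonomy V (a.1.1 + (fun i => ((z.1 i : ℤ) : ZMod L))) μ' ν'))) • vecQuat (((V (Site.shift a.1.1 a.1.2, ν) * (V (Site.shift a.1.1 ν, a.1.2))⁻¹ * (V (a.1.1, ν))⁻¹)⁻¹ : Matrix.specialUnitaryGroup (Fin 2) ℂ) : Matrix (Fin 2) (Fin 2) ℂ) +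
              ((fun s μ ν t F => κt / (2 * ((d - 1 : ℕ) : ℝ)) * Real.tanh (Ψ s μ ν t F)) s a.1.2 ν 1 (fun z : {z : Fin d → ℤ // ∀ i, |z i| ≤ ((m : ℕ) : ℤ)} =>
          feat s (ZMod.cast (∑ j, (a.1.1 + (fun i => ((z.1 i : ℤ) : ZMod L))) j) : ZMod w) (fun μ' ν' => plaquetteHolonomy V (a.1.1 + (fun i => ((z.1 i : ℤ) : ZMod L))) μ' ν'))) • vecQuat ((((V (Site.shift (a.1.1 - Pi.single ν 1) a.1.2, ν))⁻¹ * (V (a.1.1 - Pi.single ν 1, a.1.2))⁻¹ * V (a.1.1 - Pi.single ν 1, ν))⁻¹ : Matrix.specialUnitaryGroup (Fin 2) ℂ) : Matrix (Fin 2) (Fin 2) ℂ))) (vecQuat ((V a.1 : Matrix.specialUnitaryGroup (Fin 2) ℂ) : Matrix (Fin 2) (Fin 2) ℂ)))) ^ 3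
          else kickJac (cf s * ‖(∑ ν ∈ Finset.univ.erase a.1.2,
            (((fun s μ ν t F => κt / (2 * ((d - 1 : ℕ) : ℝ)) * Real.tanh (Ψ s μ ν t F)) s a.1.2 ν 0 (fun z : {z : Fin d → ℤ // ∀ i, |z i| ≤ ((m : ℕ) : ℤ)} =>
          feat s (ZMod.cast (∑ j, (a.1.1 + (fun i => ((z.1 i : ℤ) : ZMod L))) j) : ZMod w) (fun μ' ν' => plaquetteHolonomy V (a.1.1 + (fun i => ((z.1 i : ℤ) : ZMod L))) μ' ν'))) • vecQuat (((V (Site.shift a.1.1 a.1.2, ν) * (V (Site.shift a.1.1 ν, a.1.2))⁻¹ * (V (a.1.1, ν))⁻¹)⁻¹ : Matrix.specialUnitaryGroup (Fin 2) ℂ) : Matrix (Fin 2) (Fin 2) ℂ) +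
              ((fun s μ ν t F => κt / (2 * ((d - 1 : ℕ) : ℝ)) * Real.tanh (Ψ s μ ν t F)) s a.1.2 ν 1 (fun z : {z : Fin d → ℤ // ∀ i, |z i| ≤ ((m : ℕ) : ℤ)} =>
          feat s (ZMod.cast (∑ j, (a.1.1 + (fun i => ((z.1 i : ℤ) : ZMod L))) j) : ZMod w) (fun μ' ν' => plaquetteHolonomy V (a.1.1 + (fun i => ((z.1 i : ℤ) : ZMod L))) μ' ν'))) • vecQuat ((((V (Site.shift (a.1.1 - Pi.single ν 1) a.1.2, ν))⁻¹ * (V (a.1.1 - Pi.single ν 1, a.1.2))⁻¹ * V (a.1.1 - Pi.single ν 1, ν))⁻¹ : Matrix.specialUnitaryGroup (Fin 2) ℂ) : Matrix (Fin 2) (Fin 2) ℂ)))‖) 2 (angle (∑ ν ∈ Finset.univ.erase a.1.2,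
            (((fun s μ ν t F => κt / (2 * ((d - 1 : ℕ) : ℝ)) * Real.tanh (Ψ s μ ν t F)) s a.1.2 ν 0 (fun z : {z : Fin d → ℤ // ∀ i, |z i| ≤ ((m : ℕ) : ℤ)} =>
          feat s (ZMod.cast (∑ j, (a.1.1 + (fun i => ((z.1 i : ℤ) : ZMod L))) j) : ZMod w) (fun μ' ν' => plaquetteHolonomy V (a.1.1 + (fun i => ((z.1 i : ℤ) : ZMod L))) μ' ν'))) • vecQuat (((V (Site.shift a.1.1 a.1.2, ν) * (V (Site.shift a.1.1 ν, a.1.2))⁻¹ * (V (a.1.1, ν))⁻¹)⁻¹ : Matrix.specialUnitaryGroup (Fin 2) ℂ) : Matrix (Fin 2) (Fin 2) ℂ) +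
              ((fun s μ ν t F => κt / (2 * ((d - 1 : ℕ) : ℝ)) * Real.tanh (Ψ s μ ν t F)) s a.1.2 ν 1 (fun z : {z : Fin d → ℤ // ∀ i, |z i| ≤ ((m : ℕ) : ℤ)} =>
          feat s (ZMod.cast (∑ j, (a.1.1 + (fun i => ((z.1 i : ℤ) : ZMod L))) j) : ZMod w) (fun μ' ν' => plaquetteHolonomy V (a.1.1 + (fun i => ((z.1 i : ℤ) : ZMod L))) μ' ν'))) • vecQuat ((((V (Site.shift (a.1.1 - Pi.single ν 1) a.1.2, ν))⁻¹ * (V (a.1.1 - Pi.single ν 1, a.1.2))⁻¹ * V (a.1.1 - Pi.single ν 1, ν))⁻¹ : Matrix.specialUnitaryGroup (Fin 2) ℂ) : Matrix (Fin 2) (Fin 2) ℂ))) (vecQuat ((V a.1 : Matrix.specialUnitaryGroup (Fin 2) ℂ) : Matrix (Fin 2) (Fin 2) ℂ)))))) ∧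
      ∃ hΦ : Measurable (fun (V : GaugeConfig d L (Matrix.specialUnitaryGroup (Fin 2) ℂ)) (l : Edge d L) => κ • WithLp.toLp 2 (fun i : Fin 3 =>
        fderiv ℝ (fun a : Edge d L → EuclideanSpace ℝ (Fin 3) => β * wilsonAction (Matrix.specialUnitaryGroup (Fin 2) ℂ).subtype ((layers.foldr (fun Ly (F : GaugeConfig d L (Matrix.specialUnitaryGroup (Fin 2) ℂ) ≃ᵐ GaugeConfig d L (Matrix.specialUnitaryGroup (Fin 2) ℂ)) => Ly.1.trans F) (MeasurableEquiv.refl (GaugeConfig d L (Matrix.specialUnitaryGroup (Fin 2) ℂ)))) ((fun l : Edge d L => expPauli (a l)) * V)) - Real.log ((layers.foldr (fun Ly K => fun v => Ly.2 v * K (Ly.1 v)) (fun _ => (1 : ℝ))) ((fun l : Edge d L => expPauli (a l)) * V))) 0 (Pi.single l (EuclideanSpace.single i (1 : ℝ))))),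
      ∀ (n : ℕ) (ε' : ℝ) (_hn : 1 ≤ n) (_hε' : 0 < ε'), n * ε' ≤ τ₀ →
        ∃ k : ℕ, ∃ δ : ℝ, 0 < δ ∧ δ ≤ 1 ∧ ∀ (μ₀ : Measure (GaugeConfig d L (Matrix.specialUnitaryGroup (Fin 2) ℂ))) [IsProbabilityMeasure μ₀] (t : ℕ) (A : Set (GaugeConfig d L (Matrix.specialUnitaryGroup (Fin 2) ℂ))),
          |((fun m : Measure (GaugeConfig d L (Matrix.specialUnitaryGroup (Fin 2) ℂ)) =>
                m.bind (conjKernel (su2LeapfrogHMCN ε' κ' (measurable_halfKick_su2 hΦ ε')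
                  (fun V : GaugeConfig d L (Matrix.specialUnitaryGroup (Fin 2) ℂ) => β * wilsonAction (Matrix.specialUnitaryGroup (Fin 2) ℂ).subtype ((layers.foldr (fun Ly (F : GaugeConfig d L (Matrix.specialUnitaryGroup (Fin 2) ℂ) ≃ᵐ GaugeConfig d L (Matrix.specialUnitaryGroup (Fin 2) ℂ)) => Ly.1.trans F) (MeasurableEquiv.refl (GaugeConfig d L (Matrix.specialUnitaryGroup (Fin 2) ℂ)))) V) - Real.log ((layers.foldr (fun Ly K => fun v => Ly.2 v * K (Ly.1 v)) (fun _ => (1 : ℝ))) V)) n) (layers.foldr (fun Ly (F : GaugeConfig d L (Matrix.specialUnitaryGroup (Fin 2) ℂ) ≃ᵐ GaugeConfig d L (Matrix.specialUnitaryGroup (Fin 2) ℂ)) => Ly.1.trans F) (MeasurableEquiv.refl (GaugeConfig d L (Matrix.specialUnitaryGroup (Fin 2) ℂ))))))^[t] μ₀).real A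
            - (wilsonMeasure (Matrix.specialUnitaryGroup (Fin 2) ℂ).subtype β).real A| ≤ (1 - δ) ^ (t / (k + 1)) :=
  su2ResidualStencil_member_fthmcN_exactForce_uniformlyErgodic_allVolumes (d := d) w μf bf cf m feat
    (fun s μ ν t F => κt / (2 * ((d - 1 : ℕ) : ℝ)) * Real.tanh (Ψ s μ ν t F))
    hρD hρC hfeatm (fun s μ ν t => (continuous_tanh_real.measurable.comp (hΨm s μ ν t)).const_mul _) hfeat hκ0 hκ₀
    (fun _ _ s _ e _ => (mul_le_mul_of_nonneg_left (sum_squash_le e.2 hκt _ _) (abs_nonneg _)).trans (hcκ s))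
    sched β κ hκ'

end Squash

end Summit.Ventures.LatticeQCDFlow.Exactness
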